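import Summits.CriticalPhenomena.PercolationContinuityZ3.Theorems.PercNearOneGluingNoHeavyLowerTailLinearSharp
import HarnessLib

/-!
# Majority gluing with an explicit loss (lane prim-rate, constants-miner 1, row M1-L2)

Support file for the closed crux `NoHeavyLowerTail` (stmt-CriticalPhenomena-4575), continuing
`PercNearOneGluingNoHeavyLowerTailLinearSharp.lean`.  ADDITIVE GLUING (`Theses.PercNearOneGluing.AdditiveGluing`, a tree theorem)
says `μ(o ↔ a₀) ≥ μ(o ↔ A) − max_{a∈A} μ(a ↮ a₀)` for a hub `a₀ ∈ A`.  MAJORITY GLUING upgrades the conclusion to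
"`o ↔ a₀` AND `o` sees a strict majority of `A`" (`2N > |A|`, `N = #{a ∈ A : o ↔ a}`) at an explicit larger loss:
`μ(o ↔ a₀ ∧ 2N > |A|) ≥ μ(o ↔ A) − C(|A|)·max_a μ(a ↮ a₀)`, `C(|A|) = 1 + (|A|−2)/⌈|A|/2⌉ < 3`, `= 2` for `|A| ≤ 5`
(`majorityGluing_two_of_card_le_five`).  The miner's exact family (5-vertex path `o – s – a₀ – h₁ – h₂`, weights
`(1, 1−d, 1−d, 1)`, `A = {s, a₀, h₁, h₂}`: deficit `(2 − d)·max`) shows the loss `2·max` cannot be lowered for any `|A| ≥ 4`;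
`2·max` for every `|A|` is the conjecture of record (row M1-L2, `run/shared/lean/prim/prim-rate/prim-rate-mine-1/CANDIDATES.md`;
local screens: all graphs `n ≤ 6` × 10 palettes and adversarial climbs `n ≤ 9`, supremum `→ 2⁻`).  Majority gluing implies the
inclusive linear lower tail WITHOUT the `μ(o ↮ A)` term: `μ(1 ≤ N ∧ 2N ≤ |A|) ≤ C(|A|)·max_a μ(a ↮ a₀)`.
No definitions, no named facts, no sorries. [cite: KozmaNitzan2024, Conj. 1 (p. 3)]
-/

noncomputable section

namespace Summit.CriticalPhenomena.PercolationContinuityZ3.Theorems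

open MeasureTheory Set
open Literature.Probability.LatticeModels (prodBernoulli)
open Literature.Probability.Percolation (openConn BondConfig measurableSet_openConn_holds)
open scoped Classical BigOperators

/-- **Majority gluing with an explicit loss (prim-rate constants-miner 1, row M1-L2), from `AdditiveGluing`.**  For a hub
`a₀ ∈ A` with `P(a ↮ a₀) ≤ δ₀` on `A`:
`μ(o ↔ A) − μ(o ↔ a₀ ∧ 2N > |A|) ≤ (1 + (|A| − 2)/⌈|A|/2⌉)·δ₀`
— additive gluing (`μ(o ↔ a₀) ≥ μ(o ↔ A) − δ₀`) upgraded to "`o` joins the hub AND sees a strict majority of `A`" at a loss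
`< 3δ₀` (`= 2δ₀` for `|A| ≤ 5`; the miner's exact family shows that `2δ₀` cannot be improved for any `|A| ≥ 4`, and `2δ₀` is
conjectured for every `|A|`).  Proof: `{o ↔ A} ∖ {o ↔ a₀, 2N > |A|} = E_H ⊔ E_B ⊔ E₃` with the blocks of `nhltlin_jointBlocks`;
`⌈|A|/2⌉·μ(E_H) + μ(E_B) + μ(E₃) ≤ (|A|−1)δ₀` (joint bookkeeping) and `μ(E_B) + μ(E₃) ≤ δ₀` (additive gluing at `b := a₀`).
[cite: KozmaNitzan2024, Conj. 1 (p. 3)] -/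
theorem majorityGluing_of_additiveGluing
    (hA : Summit.CriticalPhenomena.PercolationContinuityZ3.Theses.PercNearOneGluing.AdditiveGluing)
    (n : ℕ) (w : Sym2 (Fin n) → unitInterval) (A : Finset (Fin n)) (o a₀ : Fin n) (δ₀ : ℝ)
    (ha₀ : a₀ ∈ A) (hδ₀ : ∀ a ∈ A, (prodBernoulli w).real (openConn a a₀)ᶜ ≤ δ₀) :
    (prodBernoulli w).real (⋃ a ∈ A, openConn o a) -
        (prodBernoulli w).real {ω : BondConfig (Fin n) | ω ∈ openConn o a₀ ∧
          A.card < 2 * (A.filter fun a => ω ∈ openConn o a).card}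
      ≤ (1 + ((A.card : ℝ) - 2) / (((A.card + 1) / 2 : ℕ) : ℝ)) * δ₀ := by
  set μ := prodBernoulli w with hμ
  set k := A.card with hk
  have hδ₀0 : 0 ≤ δ₀ := le_trans measureReal_nonneg (hδ₀ a₀ ha₀)
  have hkpos : 1 ≤ k := Finset.card_pos.mpr ⟨a₀, ha₀⟩
  have hms : ∀ S : Set (BondConfig (Fin n)), MeasurableSet S := fun _ => MeasurableSet.of_discrete
  set EH : Set (BondConfig (Fin n)) := {ω | ω ∈ openConn o a₀ ∧
    2 * (A.filter fun a => ω ∈ openConn o a).card ≤ k} with hEH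
  set EB : Set (BondConfig (Fin n)) := {ω | ω ∉ openConn o a₀ ∧
    1 ≤ (A.filter fun a => ω ∈ openConn o a).card ∧ 2 * (A.filter fun a => ω ∈ openConn o a).card ≤ k} with hEB
  set E3 : Set (BondConfig (Fin n)) := {ω | ω ∉ openConn o a₀ ∧
    k < 2 * (A.filter fun a => ω ∈ openConn o a).card} with hE3
  set E0 : Set (BondConfig (Fin n)) := (⋃ a ∈ A, openConn o a)ᶜ with hE0
  set EM : Set (BondConfig (Fin n)) := {ω | ω ∈ openConn o a₀ ∧
    k < 2 * (A.filter fun a => ω ∈ openConn o a).card} with hEM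
  -- joint bookkeeping and the star budget
  have hjoint := nhltlin_jointBlocks n w A o a₀
  have hsum : (∑ a ∈ A, μ.real (openConn a a₀)ᶜ) ≤ ((k : ℝ) - 1) * δ₀ := by
    have h0 : μ.real (openConn a₀ a₀ : Set (BondConfig (Fin n)))ᶜ = 0 := by
      have : (openConn a₀ a₀ : Set (BondConfig (Fin n)))ᶜ = ∅ := by
        ext ω
        simp only [Set.mem_compl_iff, openConn, Set.mem_setOf_eq, Set.mem_empty_iff_false, iff_false, not_not]
        exact SimpleGraph.Reachable.refl _
      rw [this, measureReal_empty]
    rw [← Finset.add_sum_erase A _ ha₀, h0, zero_add]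
    calc (∑ a ∈ A.erase a₀, μ.real (openConn a a₀)ᶜ) ≤ ∑ _a ∈ A.erase a₀, δ₀ :=
          Finset.sum_le_sum fun a ha => hδ₀ a (Finset.mem_of_mem_erase ha)
      _ = ((k : ℝ) - 1) * δ₀ := by
        rw [Finset.sum_const, Finset.card_erase_of_mem ha₀, nsmul_eq_mul]
        have : ((k - 1 : ℕ) : ℝ) = (k : ℝ) - 1 := by
          rw [Nat.cast_sub hkpos]; simp
        rw [this]
  -- additive gluing at `b := a₀`
  have hrel : ∀ a ∈ A, 1 - δ₀ ≤ μ.real (openConn a a₀) := by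
    intro a ha
    have h := hδ₀ a ha
    rw [probReal_compl_eq_one_sub (hms _)] at h
    linarith
  have hglue := hA n w A o a₀ δ₀ hδ₀0 hrel
  have hAG : μ.real (openConn o a₀ : Set (BondConfig (Fin n)))ᶜ ≤ μ.real E0 + δ₀ := by
    rw [probReal_compl_eq_one_sub (hms _), hE0, probReal_compl_eq_one_sub (hms _)]
    rw [← hμ] at hglue
    linarith
  have hE0card : ∀ ω, ω ∈ E0 ↔ (A.filter fun a => ω ∈ openConn o a).card = 0 := by
    intro ω
    rw [hE0, Set.mem_compl_iff, Finset.card_eq_zero, Finset.filter_eq_empty_iff]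
    simp only [Set.mem_iUnion, not_exists]
  have hE0sub : E0 ⊆ (openConn o a₀ : Set (BondConfig (Fin n)))ᶜ := by
    intro ω hω hoa
    rw [hE0, Set.mem_compl_iff] at hω
    exact hω (Set.mem_biUnion (Finset.mem_coe.2 ha₀) hoa)
  have hdisj1 : Disjoint E0 (EB ∪ E3) := by
    rw [Set.disjoint_left]
    intro ω h0 h
    have hc := (hE0card ω).1 h0
    rcases h with h | h
    · have := h.2.1; omega
    · have := h.2; omega
  have hdisj2 : Disjoint EB E3 := by
    rw [Set.disjoint_left]
    rintro ω ⟨_, _, h2⟩ ⟨_, h3⟩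
    omega
  have hcover : E0 ∪ (EB ∪ E3) ⊆ (openConn o a₀ : Set (BondConfig (Fin n)))ᶜ := by
    rintro ω (h | h | h)
    · exact hE0sub h
    · exact h.1
    · exact h.1
  have hparts : μ.real E0 + (μ.real EB + μ.real E3) ≤ μ.real (openConn o a₀ : Set (BondConfig (Fin n)))ᶜ := by
    rw [← measureReal_union hdisj2 (hms _), ← measureReal_union hdisj1 ((hms _).union (hms _))]
    exact measureReal_mono hcover
  have hB3 : μ.real EB + μ.real E3 ≤ δ₀ := by linarith
  -- `{o ↔ A} ⊆ EM ∪ EH ∪ EB ∪ E3`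
  have hsplit : (⋃ a ∈ A, (openConn o a : Set (BondConfig (Fin n)))) ⊆ EM ∪ (EH ∪ (EB ∪ E3)) := by
    intro ω hω
    have hN : 1 ≤ (A.filter fun a => ω ∈ openConn o a).card := by
      by_contra h0
      have hz : (A.filter fun a => ω ∈ openConn o a).card = 0 := by omega
      exact ((hE0card ω).2 hz) hω
    by_cases hoa : ω ∈ openConn o a₀
    · by_cases hM : k < 2 * (A.filter fun a => ω ∈ openConn o a).card
      · exact Or.inl ⟨hoa, hM⟩
      · exact Or.inr (Or.inl ⟨hoa, by omega⟩)
    · by_cases hM : k < 2 * (A.filter fun a => ω ∈ openConn o a).card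
      · exact Or.inr (Or.inr (Or.inr ⟨hoa, hM⟩))
      · exact Or.inr (Or.inr (Or.inl ⟨hoa, hN, by omega⟩))
  have u0 : μ.real (⋃ a ∈ A, (openConn o a : Set (BondConfig (Fin n)))) ≤ μ.real (EM ∪ (EH ∪ (EB ∪ E3))) :=
    measureReal_mono hsplit
  have u1 : μ.real (EM ∪ (EH ∪ (EB ∪ E3))) ≤ μ.real EM + μ.real (EH ∪ (EB ∪ E3)) := measureReal_union_le _ _
  have u2 : μ.real (EH ∪ (EB ∪ E3)) ≤ μ.real EH + μ.real (EB ∪ E3) := measureReal_union_le _ _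
  have u3 : μ.real (EB ∪ E3) ≤ μ.real EB + μ.real E3 := measureReal_union_le _ _
  have hUA : μ.real (⋃ a ∈ A, (openConn o a : Set (BondConfig (Fin n)))) ≤
      μ.real EM + (μ.real EH + (μ.real EB + μ.real E3)) := by linarith
  -- arithmetic as in `linearLowerTailInclusive_sharp_of_additiveGluing`
  set c : ℝ := (((k + 1) / 2 : ℕ) : ℝ) with hc
  set f : ℝ := (((k / 2 + 1 : ℕ)) : ℝ) with hf
  have hc1 : 1 ≤ c := by
    have : 1 ≤ (k + 1) / 2 := by omega
    rw [hc]; exact_mod_cast this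
  have hf1 : 1 ≤ f := by
    have : 1 ≤ k / 2 + 1 := by omega
    rw [hf]; exact_mod_cast this
  have hcpos : 0 < c := by linarith
  have hH0 : 0 ≤ μ.real EH := measureReal_nonneg
  have hB0 : 0 ≤ μ.real EB := measureReal_nonneg
  have hP30 : 0 ≤ μ.real E3 := measureReal_nonneg
  rw [← hμ] at hjoint
  have hj : c * μ.real EH + μ.real EB + f * μ.real E3 ≤ ((k : ℝ) - 1) * δ₀ := hjoint.trans hsum
  have hkey : c * (μ.real EH + μ.real EB + μ.real E3) ≤ ((k : ℝ) - 2 + c) * δ₀ := by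
    nlinarith [hj, hB3, hc1, hf1, hP30, hB0, hδ₀0, hH0]
  have hfinal : μ.real EH + μ.real EB + μ.real E3 ≤ (1 + ((k : ℝ) - 2) / c) * δ₀ := by
    rw [show (1 + ((k : ℝ) - 2) / c) * δ₀ = (((k : ℝ) - 2 + c) * δ₀) / c by field_simp; ring]
    rw [le_div_iff₀ hcpos]
    linarith [hkey]
  have hEM : μ.real EM = μ.real {ω : BondConfig (Fin n) | ω ∈ openConn o a₀ ∧
      A.card < 2 * (A.filter fun a => ω ∈ openConn o a).card} := by rw [hEM]
  linarith [hUA, hfinal, hEM]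

/-- **Majority gluing with loss `2δ₀` for `|A| ≤ 5`, unconditionally:**
`μ(o ↔ a₀ ∧ 2N > |A|) ≥ μ(o ↔ A) − 2·max_{a∈A} μ(a ↮ a₀)`.  The constant `2` is sharp for `|A| ∈ {4, 5}`.
[cite: KozmaNitzan2024, Conj. 1 (p. 3)] -/
theorem majorityGluing_two_of_card_le_five
    (n : ℕ) (w : Sym2 (Fin n) → unitInterval) (A : Finset (Fin n)) (o a₀ : Fin n) (δ₀ : ℝ)
    (ha₀ : a₀ ∈ A) (hA5 : A.card ≤ 5) (hδ₀ : ∀ a ∈ A, (prodBernoulli w).real (openConn a a₀)ᶜ ≤ δ₀) :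
    (prodBernoulli w).real (⋃ a ∈ A, openConn o a) - 2 * δ₀ ≤
      (prodBernoulli w).real {ω : BondConfig (Fin n) | ω ∈ openConn o a₀ ∧
          A.card < 2 * (A.filter fun a => ω ∈ openConn o a).card} := by
  have h := majorityGluing_of_additiveGluing CSH.additiveGluing_holds n w A o a₀ δ₀ ha₀ hδ₀
  have hδ₀0 : 0 ≤ δ₀ := le_trans measureReal_nonneg (hδ₀ a₀ ha₀)
  have hkpos : 1 ≤ A.card := Finset.card_pos.mpr ⟨a₀, ha₀⟩
  have hconst : (1 + ((A.card : ℝ) - 2) / (((A.card + 1) / 2 : ℕ) : ℝ)) ≤ 2 := by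
    have hcpos : (0 : ℝ) < (((A.card + 1) / 2 : ℕ) : ℝ) := by
      have : 1 ≤ (A.card + 1) / 2 := by omega
      exact_mod_cast this
    have key : ((A.card : ℝ) - 2) ≤ (((A.card + 1) / 2 : ℕ) : ℝ) := by
      interval_cases hk : A.card <;> norm_num
    have : ((A.card : ℝ) - 2) / (((A.card + 1) / 2 : ℕ) : ℝ) ≤ 1 := by
      rw [div_le_one hcpos]; exact key
    linarith
  have := mul_le_mul_of_nonneg_right hconst hδ₀0
  linarith

end Summit.CriticalPhenomena.PercolationContinuityZ3.Theorems

end
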